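import Literature.NumberTheory.LFunctions.TaoLogElliottProp24
import Literature.NumberTheory.LFunctions.TaoLogElliottCore
import HarnessLib

/-!
# Tao's log-averaged Elliott theorem from the Matomäki–Radziwiłł–Tao exponential sum estimate

Topic `Literature/NumberTheory/LFunctions`.  Everything in this file is PROVED (no named facts are
introduced).  It closes one of the two leaves of the proof DAG of the named fact
`Literature.NumberTheory.LFunctions.tao_log_averaged_elliott_two` (Tao, Forum Math. Pi 4 (2016) e8, Theorem 1.3):

* `TaoLogElliottProp24.lean` proved `Literature.tao_log_averaged_elliott_two_of_MRT_core :
  MatomakiRadziwillTao2015_theorem17 → Tao2016_theorem23_core → tao_log_averaged_elliott_two`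
  (the §2 reductions `Tao2016_prop21`, `Tao2016_prop22`, Proposition 2.4 and the architecture of
  Theorem 2.3 being proved in `TaoLogElliottSection2/CMization/Unimodular/Prop21/Theorem23/Prop24`);
* `TaoLogElliottCore.lean` has now proved `Literature.Tao2016.Tao2016_theorem23_core_holds :
  Tao2016_theorem23_core` (Tao 2016, the proof of Theorem 2.3 from (2.10): Lemma 2.5,
  Proposition 2.6, the entropy decrement argument and §§3–4).

Hence Theorem 1.3, Theorem 2.3 and the §2 statement `Tao2016_theorem23` all follow from the single
remaining named fact `Literature.NumberTheory.LFunctions.MatomakiRadziwillTao2015_theorem17` (Matomäki–Radziwiłł–Tao, Algebra &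
Number Theory 9 (2015), Theorem 1.7 — the short exponential sum estimate for non-pretentious
multiplicative functions, itself resting on the Matomäki–Radziwiłł theorem):

* `Tao2016_theorem23_of_MRT : MatomakiRadziwillTao2015_theorem17 → Tao2016_theorem23`;
* `tao_log_averaged_elliott_two_of_MRT : MatomakiRadziwillTao2015_theorem17 →
  tao_log_averaged_elliott_two`.

## References
* T. Tao, *The logarithmically averaged Chowla and Elliott conjectures for two-point
  correlations*, Forum Math. Pi 4 (2016), e8; arXiv:1509.05422, Theorem 1.3, §2 (Theorem 2.3,
  Proposition 2.4 and the remark following it), §§3–4. [cite: TaoFMP2016, Theorem 1.3]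
* K. Matomäki, M. Radziwiłł, T. Tao, *An averaged form of Chowla's conjecture*, Algebra & Number
  Theory 9 (2015), 2167–2196, Theorem 1.7.
-/

namespace Literature.NumberTheory.LFunctions

/-- **Tao 2016, Theorem 2.3, from Matomäki–Radziwiłł–Tao 2015, Theorem 1.7**: Proposition 2.4
(`Tao2016_prop24_of_MRT`) and the now proved core of the argument
(`Tao2016.Tao2016_theorem23_core_holds`). [cite: TaoFMP2016, Theorem 2.3] -/
theorem Tao2016_theorem23_of_MRT (hMRT : MatomakiRadziwillTao2015_theorem17) :
    Tao2016_theorem23 :=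
  Tao2016_theorem23_of_MRT_core hMRT Tao2016.Tao2016_theorem23_core_holds

/-- **Tao 2016, Theorem 1.3 (the logarithmically averaged Elliott conjecture for two-point
correlations), from Matomäki–Radziwiłł–Tao 2015, Theorem 1.7**: the named fact
`Literature.NumberTheory.LFunctions.tao_log_averaged_elliott_two` follows from the single named fact
`Literature.NumberTheory.LFunctions.MatomakiRadziwillTao2015_theorem17`, everything else in Tao's paper being proved in the tree.
[cite: TaoFMP2016, Theorem 1.3] -/
theorem tao_log_averaged_elliott_two_of_MRT (hMRT : MatomakiRadziwillTao2015_theorem17) :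
    tao_log_averaged_elliott_two :=
  tao_log_averaged_elliott_two_of_MRT_core hMRT Tao2016.Tao2016_theorem23_core_holds

end Literature.NumberTheory.LFunctions
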